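import Mathlib
import HarnessLib
import Literature.Analysis.SpecialFunctions.SelbergAnalyticLemmas
import Literature.Analysis.FunctionSpaces.BesselIGeneratingFunction
import Summits.Ventures.LatticeQCDFlow.Scaling.WilsonIdentityFlowLaw
import Summits.Ventures.LatticeQCDFlow.Scaling.U1IdentityFlowVolumeLaw
import Summits.Ventures.LatticeQCDFlow.Scoring.OnePlaquetteBesselRatioMonotone

/-!
# LatticeQCDFlow / Scaling — the untrained sampler degrades MONOTONICALLY in the coupling:
# `β ↦ Z(β/2)²/Z(β)` (acceptance ceiling) and `β ↦ Z(β)²/Z(2β)` (ESS) are non-increasing on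
# `[0, ∞)` for every exponential-tilt family, hence for every Wilson theory and for U(1) plaquettes

HONEST FRAMING: exact (Metropolis-corrected) sampling algorithms for lattice gauge theory;
figures of merit are autocorrelation/cost numbers at stated couplings and volumes; no
continuum-physics claim.

Venture `LatticeQCDFlow` (cell pub-lqcd), topic `Scaling`; FANOUT row 3 (`s0-u1-a`, S0-B
implementation A, GEN-16).  NEW WORK of the cell (elementary convexity), not a published result;
NO definition is introduced.  Row 3's identity-flow laws (`Scaling/WilsonIdentityFlowLaw`,
`U1IdentityFlowVolumeLaw`, `SU2IdentityFlowVolumeLaw`, GEN-12/13) pin the untrained exact sampler of a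
Boltzmann tilt `p_β = e^{βT}/Z(β)` of its own proposal law `μ` by two ratios of the partition
function `Z(β) = ∫ e^{βT} dμ` (Mathlib's `mgf T μ β`): the Bhattacharyya ceiling of the acceptance
`BC² = Z(β/2)²/(Z(β)Z(0))` and the effective sample size `ESS = Z(β)²/(Z(2β)Z(0))`.  Both are
`exp` of a SECOND DIFFERENCE of the convex function `log Z` (Hölder; the tree's
`Literature…Selberg.convexOn_log_mgf`), and a second difference of a convex function over nested
intervals is monotone.  Consequently (value-free; every `β`, every volume):

* §1 `slope_le_slope_of_convexOn` — for a convex `f` and intervals `[a, b]`, `[c, d]` with `a ≤ c`,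
  `b ≤ d`: `(f b − f a)/(b − a) ≤ (f d − f c)/(d − c)`; hence **`antitoneOn_two_mul_half_sub`**
  (`β ↦ 2f(β/2) − f(β)` is non-increasing on `[0, ∞)` when `f` is convex there),
  `monotoneOn_two_mul_half_sub` (non-decreasing on `(−∞, 0]`), and the doubled forms
  `antitoneOn_two_mul_sub_double` / `monotoneOn_two_mul_sub_double` (`β ↦ 2f(β) − f(2β)`);
* §2 ANY tilt family (`μ ≠ 0`, `T` a.e.-measurable with all exponential moments):
  **`mgf_half_sq_div_antitoneOn`** `β ↦ Z(β/2)²/Z(β)` non-increasing on `[0, ∞)` and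
  `mgf_half_sq_div_monotoneOn` non-decreasing on `(−∞, 0]`; **`mgf_sq_div_double_antitoneOn`** /
  `mgf_sq_div_double_monotoneOn` the same for `β ↦ Z(β)²/Z(2β)`;
* §3 WILSON lattice gauge theory, every compact `G`, continuous `ρ`, `d`, `L`, reference probability
  law `μ` (`Z_μ(β) = ∫ e^{−βS} dμ`): **`wilsonIdentityFlow_bhattSq_antitoneOn`** (the acceptance
  ceiling `Z_μ(β/2)²/Z_μ(β)` of `Scaling/WilsonIdentityFlowLaw` is non-increasing in `β ≥ 0`),
  **`wilsonIdentityFlow_essFrac_antitoneOn`** (the ESS `Z_μ(β)²/Z_μ(2β)` likewise) and the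
  `partitionFunction` (product-Haar) forms;
* §4 U(1) one-plaquette law (row 5's `convexOn_log_onePlaquetteZ`, imported; parity from
  `besselI_neg_arg`): **`antitoneOn_besselI_half_sq_div`** `β ↦ I₀(β/2)²/I₀(β)` and
  **`antitoneOn_besselI_sq_div_double`** `β ↦ I₀(β)²/I₀(2β)` are non-increasing on `[0, ∞)` and
  (being EVEN) non-decreasing on `(−∞, 0]`; the `V`-plaquette forms
  **`u1IdentityFlow_essFrac_antitoneOn`** (the exact ESS `(I₀(β)²/I₀(2β))^V` of row 3's untrained
  U(1) sampler, `u1IdentityFlow_essFrac`, is non-increasing in `|β|`) and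
  **`u1IdentityFlow_bhattCeiling_antitoneOn`**.

Reading (value-free; no number of ours is computed or implied): along every coupling ray the
untrained (identity-flow) exact sampler can only get worse — its ESS and the Bhattacharyya ceiling of
its acceptance are non-increasing functions of `|β|` for U(1) plaquettes and of `β ≥ 0` for every
Wilson theory and every reference law; so a zero-training LEADERBOARD row at one coupling bounds the
same row at every larger coupling.  NOT CLAIMED: monotonicity of the acceptance ITSELF (only of its
closed-form ceiling and of the ESS); strictness and the SU(2) class-angle law (sequels); any value at
the cell's `(β, L)`; nothing re-scored, SEALED.md untouched.
-/

noncomputable section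

namespace Summit.Ventures.LatticeQCDFlow.Theory2

open MeasureTheory Real Set ProbabilityTheory
open Literature.Analysis.FunctionSpaces (besselI besselI_zero_pos besselI_neg_arg)
open Summit.Ventures.LatticeQCDFlow.Scoring (onePlaquetteZ onePlaquetteZ_pos onePlaquetteZ_eq_besselI
  convexOn_log_onePlaquetteZ)

/-! ## §1 Second differences of a convex function over nested intervals -/

section Convex

variable {s : Set ℝ} {f : ℝ → ℝ}

/-- **Secant slopes of a convex function are monotone in BOTH endpoints**: for `a < b`, `c < d` in
`s` with `a ≤ c` and `b ≤ d`, `(f b − f a)/(b − a) ≤ (f d − f c)/(d − c)`. [folklore] -/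
theorem slope_le_slope_of_convexOn (hf : ConvexOn ℝ s f) {a b c d : ℝ} (ha : a ∈ s) (hb : b ∈ s)
    (hc : c ∈ s) (hd : d ∈ s) (hab : a < b) (hcd : c < d) (hac : a ≤ c) (hbd : b ≤ d) :
    (f b - f a) / (b - a) ≤ (f d - f c) / (d - c) := by
  have had : a < d := lt_of_lt_of_le hab hbd
  have h1 : (f b - f a) / (b - a) ≤ (f d - f a) / (d - a) :=
    hf.secant_mono ha hb hd hab.ne' had.ne' hbd
  have h2 : (f a - f d) / (a - d) ≤ (f c - f d) / (c - d) :=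
    hf.secant_mono hd ha hc had.ne hcd.ne hac
  have e1 : (f a - f d) / (a - d) = (f d - f a) / (d - a) := by
    rw [← neg_div_neg_eq, neg_sub, neg_sub]
  have e2 : (f c - f d) / (c - d) = (f d - f c) / (d - c) := by
    rw [← neg_div_neg_eq, neg_sub, neg_sub]
  rw [e1, e2] at h2
  exact h1.trans h2

/-- **`β ↦ 2f(β/2) − f(β)` is non-increasing on `[0, ∞)`** for `f` convex on `[0, ∞)` (the slope of
`f` over `[s/2, t/2]` is at most its slope over `[s, t]`). [ours] -/
theorem antitoneOn_two_mul_half_sub (hf : ConvexOn ℝ (Ici 0) f) :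
    AntitoneOn (fun β => 2 * f (β / 2) - f β) (Ici (0 : ℝ)) := by
  intro s hs t ht hst
  rcases hst.eq_or_lt with rfl | hlt
  · exact le_rfl
  have hs0 : (0 : ℝ) ≤ s := hs
  have key := slope_le_slope_of_convexOn hf (a := s / 2) (b := t / 2) (c := s) (d := t)
    (mem_Ici.2 (by linarith)) (mem_Ici.2 (by linarith [mem_Ici.1 ht])) hs ht (by linarith) hlt
    (by linarith) (by linarith [mem_Ici.1 ht])
  have hba : 0 < t - s := sub_pos.2 hlt
  have h' : (f (t / 2) - f (s / 2)) * (t - s) ≤ (f t - f s) * (t / 2 - s / 2) := by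
    rwa [div_le_div_iff₀ (by linarith) hba] at key
  show 2 * f (t / 2) - f t ≤ 2 * f (s / 2) - f s
  nlinarith [h', hba]

/-- **`β ↦ 2f(β/2) − f(β)` is non-decreasing on `(−∞, 0]`** for `f` convex on `(−∞, 0]`. [ours] -/
theorem monotoneOn_two_mul_half_sub (hf : ConvexOn ℝ (Iic 0) f) :
    MonotoneOn (fun β => 2 * f (β / 2) - f β) (Iic (0 : ℝ)) := by
  intro s hs t ht hst
  rcases hst.eq_or_lt with rfl | hlt
  · exact le_rfl
  have ht0 : t ≤ (0 : ℝ) := ht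
  have hs0 : s ≤ (0 : ℝ) := hs
  have key := slope_le_slope_of_convexOn hf (a := s) (b := t) (c := s / 2) (d := t / 2) hs ht
    (mem_Iic.2 (by linarith)) (mem_Iic.2 (by linarith)) hlt (by linarith) (by linarith) (by linarith)
  -- slope over `[s, t]` ≤ slope over `[s/2, t/2]`, i.e. `f t − f s ≤ 2 (f(t/2) − f(s/2))`
  have hba : 0 < t - s := sub_pos.2 hlt
  have h' : (f t - f s) * (t / 2 - s / 2) ≤ (f (t / 2) - f (s / 2)) * (t - s) := by
    rwa [div_le_div_iff₀ hba (by linarith)] at key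
  show 2 * f (s / 2) - f s ≤ 2 * f (t / 2) - f t
  nlinarith [h', hba]

/-- **`β ↦ 2f(β) − f(2β)` is non-increasing on `[0, ∞)`** for `f` convex on `[0, ∞)`. [ours] -/
theorem antitoneOn_two_mul_sub_double (hf : ConvexOn ℝ (Ici 0) f) :
    AntitoneOn (fun β => 2 * f β - f (2 * β)) (Ici (0 : ℝ)) := by
  intro s hs t ht hst
  have h := antitoneOn_two_mul_half_sub hf (a := 2 * s) (b := 2 * t)
    (mem_Ici.2 (by linarith [mem_Ici.1 hs])) (mem_Ici.2 (by linarith [mem_Ici.1 ht])) (by linarith)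
  simpa [mul_div_cancel_left₀ _ (two_ne_zero' ℝ)] using h

/-- **`β ↦ 2f(β) − f(2β)` is non-decreasing on `(−∞, 0]`** for `f` convex on `(−∞, 0]`. [ours] -/
theorem monotoneOn_two_mul_sub_double (hf : ConvexOn ℝ (Iic 0) f) :
    MonotoneOn (fun β => 2 * f β - f (2 * β)) (Iic (0 : ℝ)) := by
  intro s hs t ht hst
  have h := monotoneOn_two_mul_half_sub hf (a := 2 * s) (b := 2 * t)
    (mem_Iic.2 (by linarith [mem_Iic.1 hs])) (mem_Iic.2 (by linarith [mem_Iic.1 ht])) (by linarith)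
  simpa [mul_div_cancel_left₀ _ (two_ne_zero' ℝ)] using h

/-- `e^{2 log a − log b} = a²/b` for `a, b > 0`. [folklore] -/
theorem exp_two_mul_log_sub_log {a b : ℝ} (ha : 0 < a) (hb : 0 < b) :
    Real.exp (2 * Real.log a - Real.log b) = a ^ 2 / b := by
  rw [show (2 : ℝ) * Real.log a = Real.log (a ^ 2) by rw [Real.log_pow]; norm_num, Real.exp_sub,
    Real.exp_log (pow_pos ha 2), Real.exp_log hb]

/-- Transfer: if `F > 0` and `β ↦ 2 log F(β/2) − log F(β)` is antitone on a set, so is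
`β ↦ F(β/2)²/F(β)`. [folklore] -/
theorem antitoneOn_half_sq_div_of_log {F : ℝ → ℝ} {S : Set ℝ} (hF : ∀ β, 0 < F β)
    (h : AntitoneOn (fun β => 2 * Real.log (F (β / 2)) - Real.log (F β)) S) :
    AntitoneOn (fun β => F (β / 2) ^ 2 / F β) S := by
  intro s hs t ht hst
  simpa only [exp_two_mul_log_sub_log (hF _) (hF _)] using Real.exp_le_exp.2 (h hs ht hst)

/-- Transfer (monotone form). [folklore] -/
theorem monotoneOn_half_sq_div_of_log {F : ℝ → ℝ} {S : Set ℝ} (hF : ∀ β, 0 < F β)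
    (h : MonotoneOn (fun β => 2 * Real.log (F (β / 2)) - Real.log (F β)) S) :
    MonotoneOn (fun β => F (β / 2) ^ 2 / F β) S := by
  intro s hs t ht hst
  simpa only [exp_two_mul_log_sub_log (hF _) (hF _)] using Real.exp_le_exp.2 (h hs ht hst)

/-- Transfer (doubled form): antitone `2 log F(β) − log F(2β)` gives antitone `F(β)²/F(2β)`.
[folklore] -/
theorem antitoneOn_sq_div_double_of_log {F : ℝ → ℝ} {S : Set ℝ} (hF : ∀ β, 0 < F β)
    (h : AntitoneOn (fun β => 2 * Real.log (F β) - Real.log (F (2 * β))) S) :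
    AntitoneOn (fun β => F β ^ 2 / F (2 * β)) S := by
  intro s hs t ht hst
  simpa only [exp_two_mul_log_sub_log (hF _) (hF _)] using Real.exp_le_exp.2 (h hs ht hst)

/-- Transfer (doubled, monotone form). [folklore] -/
theorem monotoneOn_sq_div_double_of_log {F : ℝ → ℝ} {S : Set ℝ} (hF : ∀ β, 0 < F β)
    (h : MonotoneOn (fun β => 2 * Real.log (F β) - Real.log (F (2 * β))) S) :
    MonotoneOn (fun β => F β ^ 2 / F (2 * β)) S := by
  intro s hs t ht hst
  simpa only [exp_two_mul_log_sub_log (hF _) (hF _)] using Real.exp_le_exp.2 (h hs ht hst)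

end Convex

/-! ## §2 Any exponential-tilt family: `Z(β) = ∫ e^{βT} dμ = mgf T μ β` -/

section Tilt

variable {Ω : Type*} [MeasurableSpace Ω] {μ : Measure Ω} [NeZero μ] {T : Ω → ℝ}

/-- `log Z` is convex on `ℝ` when all exponential moments exist (Hölder; the tree's
`Selberg.convexOn_log_mgf`). [folklore] -/
theorem convexOn_log_mgf_univ (hT : AEMeasurable T μ)
    (hint : ∀ t, Integrable (fun ω => Real.exp (t * T ω)) μ) :
    ConvexOn ℝ univ (fun t => Real.log (mgf T μ t)) :=
  Literature.Analysis.SpecialFunctions.Selberg.convexOn_log_mgf hT convex_univ fun t _ => hint t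

/-- **The Bhattacharyya-ceiling ratio `β ↦ Z(β/2)²/Z(β)` is non-increasing on `[0, ∞)`** for every
tilt family with all exponential moments. [ours] -/
theorem mgf_half_sq_div_antitoneOn (hT : AEMeasurable T μ)
    (hint : ∀ t, Integrable (fun ω => Real.exp (t * T ω)) μ) :
    AntitoneOn (fun β => mgf T μ (β / 2) ^ 2 / mgf T μ β) (Ici (0 : ℝ)) :=
  antitoneOn_half_sq_div_of_log (fun β => mgf_pos' (NeZero.ne μ) (hint β))
    (antitoneOn_two_mul_half_sub
      ((convexOn_log_mgf_univ hT hint).subset (subset_univ _) (convex_Ici 0)))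

/-- **`β ↦ Z(β/2)²/Z(β)` is non-decreasing on `(−∞, 0]`.** [ours] -/
theorem mgf_half_sq_div_monotoneOn (hT : AEMeasurable T μ)
    (hint : ∀ t, Integrable (fun ω => Real.exp (t * T ω)) μ) :
    MonotoneOn (fun β => mgf T μ (β / 2) ^ 2 / mgf T μ β) (Iic (0 : ℝ)) :=
  monotoneOn_half_sq_div_of_log (fun β => mgf_pos' (NeZero.ne μ) (hint β))
    (monotoneOn_two_mul_half_sub
      ((convexOn_log_mgf_univ hT hint).subset (subset_univ _) (convex_Iic 0)))

/-- **The ESS ratio `β ↦ Z(β)²/Z(2β)` is non-increasing on `[0, ∞)`.** [ours] -/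
theorem mgf_sq_div_double_antitoneOn (hT : AEMeasurable T μ)
    (hint : ∀ t, Integrable (fun ω => Real.exp (t * T ω)) μ) :
    AntitoneOn (fun β => mgf T μ β ^ 2 / mgf T μ (2 * β)) (Ici (0 : ℝ)) :=
  antitoneOn_sq_div_double_of_log (fun β => mgf_pos' (NeZero.ne μ) (hint β))
    (antitoneOn_two_mul_sub_double
      ((convexOn_log_mgf_univ hT hint).subset (subset_univ _) (convex_Ici 0)))

/-- **`β ↦ Z(β)²/Z(2β)` is non-decreasing on `(−∞, 0]`.** [ours] -/
theorem mgf_sq_div_double_monotoneOn (hT : AEMeasurable T μ)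
    (hint : ∀ t, Integrable (fun ω => Real.exp (t * T ω)) μ) :
    MonotoneOn (fun β => mgf T μ β ^ 2 / mgf T μ (2 * β)) (Iic (0 : ℝ)) :=
  monotoneOn_sq_div_double_of_log (fun β => mgf_pos' (NeZero.ne μ) (hint β))
    (monotoneOn_two_mul_sub_double
      ((convexOn_log_mgf_univ hT hint).subset (subset_univ _) (convex_Iic 0)))

end Tilt

/-! ## §3 Wilson lattice gauge theory: `Z_μ(β) = ∫ e^{−βS} dμ` for any reference law `μ` -/

section Wilson

open Literature.MathematicalPhysics.QuantumFieldTheory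

variable {d L N : ℕ} [NeZero L] {G : Type*} [Group G] [TopologicalSpace G] [IsTopologicalGroup G]
  [CompactSpace G] [MeasurableSpace G] [BorelSpace G] (ρ : G →* Matrix (Fin N) (Fin N) ℂ)
  (μ : Measure (GaugeConfig d L G)) [IsProbabilityMeasure μ]

omit [TopologicalSpace G] [IsTopologicalGroup G] [CompactSpace G] [BorelSpace G]
  [IsProbabilityMeasure μ] in
/-- `Z_μ(β) = ∫ e^{−βS} dμ` is the moment generating function of `−S` at `β`. [folklore] -/
theorem wilsonZI_eq_mgf (β : ℝ) :
    ∫ U, Real.exp (-β * wilsonAction ρ U) ∂μ = mgf (fun U => -wilsonAction ρ U) μ β := by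
  simp only [mgf, neg_mul, mul_neg]

omit [IsProbabilityMeasure μ] in
/-- All exponential moments of `−S` exist under any finite reference law (continuous `ρ`).
[folklore] -/
theorem integrable_exp_mul_neg_wilsonAction [IsFiniteMeasure μ] (hρ : Continuous ρ) (t : ℝ) :
    Integrable (fun U : GaugeConfig d L G => Real.exp (t * -wilsonAction ρ U)) μ := by
  have h := integrable_exp_mul_wilsonAction ρ hρ (-t) μ
  simpa only [neg_mul, mul_neg] using h

omit [CompactSpace G] [IsProbabilityMeasure μ] in
/-- `−S` is measurable (continuous `ρ`). [folklore] -/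
theorem aemeasurable_neg_wilsonAction (hρ : Continuous ρ) :
    AEMeasurable (fun U : GaugeConfig d L G => -wilsonAction ρ U) μ :=
  (WilsonRP.measurable_wilsonAction ρ hρ).neg.aemeasurable

/-- **The acceptance ceiling `Z_μ(β/2)²/Z_μ(β)` of the untrained Wilson sampler is non-increasing in
`β ≥ 0`** — every compact `G`, continuous `ρ`, `d`, `L`, reference probability law `μ`. [ours] -/
theorem wilsonIdentityFlow_bhattSq_antitoneOn (hρ : Continuous ρ) :
    AntitoneOn (fun β => (∫ U, Real.exp (-(β / 2) * wilsonAction ρ U) ∂μ) ^ 2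
        / ∫ U, Real.exp (-β * wilsonAction ρ U) ∂μ) (Ici (0 : ℝ)) := by
  simp_rw [wilsonZI_eq_mgf ρ μ]
  exact mgf_half_sq_div_antitoneOn (aemeasurable_neg_wilsonAction ρ μ hρ)
    (integrable_exp_mul_neg_wilsonAction ρ μ hρ)

/-- **The exact ESS `Z_μ(β)²/Z_μ(2β)` of the untrained Wilson sampler
(`Scaling/WilsonIdentityFlowLaw.wilsonIdentityFlow_essFrac`) is non-increasing in `β ≥ 0`.** [ours] -/
theorem wilsonIdentityFlow_essFrac_antitoneOn (hρ : Continuous ρ) :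
    AntitoneOn (fun β => (∫ U, Real.exp (-β * wilsonAction ρ U) ∂μ) ^ 2
        / ∫ U, Real.exp (-(2 * β) * wilsonAction ρ U) ∂μ) (Ici (0 : ℝ)) := by
  simp_rw [wilsonZI_eq_mgf ρ μ]
  exact mgf_sq_div_double_antitoneOn (aemeasurable_neg_wilsonAction ρ μ hρ)
    (integrable_exp_mul_neg_wilsonAction ρ μ hρ)

/-- **Product-Haar reference law** (the cell's identity flow), `Z = (partitionFunction ρ ·).toReal`:
`β ↦ Z(β/2)²/Z(β)` is non-increasing on `[0, ∞)`. [ours] -/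
theorem wilsonIdentityFlow_bhattSq_antitoneOn_partitionFunction (hρ : Continuous ρ) :
    AntitoneOn (fun β => (partitionFunction (d := d) (L := L) ρ (β / 2)).toReal ^ 2
        / (partitionFunction (d := d) (L := L) ρ β).toReal) (Ici (0 : ℝ)) := by
  simp_rw [partitionFunction_toReal_eq_integral ρ hρ]
  exact wilsonIdentityFlow_bhattSq_antitoneOn ρ _ hρ

/-- Product Haar: **the untrained sampler's ESS `Z(β)²/Z(2β)` is non-increasing on `[0, ∞)`.**
[ours] -/
theorem wilsonIdentityFlow_essFrac_antitoneOn_partitionFunction (hρ : Continuous ρ) :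
    AntitoneOn (fun β => (partitionFunction (d := d) (L := L) ρ β).toReal ^ 2
        / (partitionFunction (d := d) (L := L) ρ (2 * β)).toReal) (Ici (0 : ℝ)) := by
  simp_rw [partitionFunction_toReal_eq_integral ρ hρ]
  exact wilsonIdentityFlow_essFrac_antitoneOn ρ _ hρ

end Wilson

/-! ## §4 U(1) plaquettes: the Bessel ratios are non-increasing in `|β|` -/

section U1

/-- `I₀` is even. [folklore] -/
theorem besselI_zero_neg (x : ℝ) : besselI 0 (-x) = besselI 0 x := by
  rw [besselI_neg_arg, pow_zero, one_mul]

/-- `log I₀` is convex on `ℝ` (row 5's `convexOn_log_onePlaquetteZ`, `Z = 2π I₀`). [ours] -/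
theorem convexOn_log_besselI_zero : ConvexOn ℝ univ fun β => Real.log (besselI 0 β) := by
  have h := convexOn_log_onePlaquetteZ
  have e : (fun β => Real.log (besselI 0 β))
      = fun β => Real.log (onePlaquetteZ β) + (-Real.log (2 * π)) := by
    funext β
    rw [onePlaquetteZ_eq_besselI, mul_comm, Real.log_mul (besselI_zero_pos β).ne' (by positivity)]
    ring
  rw [e]
  exact h.add (convexOn_const _ convex_univ)

/-- **`β ↦ I₀(β/2)²/I₀(β)` — the per-plaquette Bhattacharyya ceiling `BC₁²` of the untrained U(1)
sampler — is non-increasing on `[0, ∞)`.** [ours] -/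
theorem antitoneOn_besselI_half_sq_div :
    AntitoneOn (fun β : ℝ => besselI 0 (β / 2) ^ 2 / besselI 0 β) (Ici (0 : ℝ)) :=
  antitoneOn_half_sq_div_of_log besselI_zero_pos
    (antitoneOn_two_mul_half_sub (convexOn_log_besselI_zero.subset (subset_univ _) (convex_Ici 0)))

/-- **`β ↦ I₀(β/2)²/I₀(β)` is EVEN, hence non-decreasing on `(−∞, 0]`.** [ours] -/
theorem monotoneOn_besselI_half_sq_div :
    MonotoneOn (fun β : ℝ => besselI 0 (β / 2) ^ 2 / besselI 0 β) (Iic (0 : ℝ)) := by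
  intro s hs t ht hst
  have h := antitoneOn_besselI_half_sq_div (a := -t) (b := -s)
    (mem_Ici.2 (neg_nonneg.2 (mem_Iic.1 ht))) (mem_Ici.2 (neg_nonneg.2 (mem_Iic.1 hs)))
    (neg_le_neg hst)
  simp only [neg_div, besselI_zero_neg] at h
  exact h

/-- **`β ↦ I₀(β)²/I₀(2β)` — the per-plaquette ESS of the untrained U(1) sampler — is non-increasing
on `[0, ∞)`.** [ours] -/
theorem antitoneOn_besselI_sq_div_double :
    AntitoneOn (fun β : ℝ => besselI 0 β ^ 2 / besselI 0 (2 * β)) (Ici (0 : ℝ)) :=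
  antitoneOn_sq_div_double_of_log besselI_zero_pos
    (antitoneOn_two_mul_sub_double
      (convexOn_log_besselI_zero.subset (subset_univ _) (convex_Ici 0)))

/-- **`β ↦ I₀(β)²/I₀(2β)` is even, hence non-decreasing on `(−∞, 0]`.** [ours] -/
theorem monotoneOn_besselI_sq_div_double :
    MonotoneOn (fun β : ℝ => besselI 0 β ^ 2 / besselI 0 (2 * β)) (Iic (0 : ℝ)) := by
  intro s hs t ht hst
  have h := antitoneOn_besselI_sq_div_double (a := -t) (b := -s)
    (mem_Ici.2 (neg_nonneg.2 (mem_Iic.1 ht))) (mem_Ici.2 (neg_nonneg.2 (mem_Iic.1 hs)))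
    (neg_le_neg hst)
  simp only [mul_neg, besselI_zero_neg] at h
  exact h

/-- Powers of a non-negative antitone function are antitone. [folklore] -/
theorem antitoneOn_pow_of_nonneg {g : ℝ → ℝ} {S : Set ℝ} (hg0 : ∀ β, 0 ≤ g β)
    (hg : AntitoneOn g S) (V : ℕ) : AntitoneOn (fun β => g β ^ V) S :=
  fun _ hs _ ht hst => pow_le_pow_left₀ (hg0 _) (hg hs ht hst) V

/-- Powers of a non-negative monotone function are monotone. [folklore] -/
theorem monotoneOn_pow_of_nonneg {g : ℝ → ℝ} {S : Set ℝ} (hg0 : ∀ β, 0 ≤ g β)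
    (hg : MonotoneOn g S) (V : ℕ) : MonotoneOn (fun β => g β ^ V) S :=
  fun _ hs _ ht hst => pow_le_pow_left₀ (hg0 _) (hg hs ht hst) V

/-- **`V` plaquettes: the Bhattacharyya ceiling `(I₀(β/2)²/I₀(β))^V` of the untrained U(1) acceptance
(`u1IdentityFlow_meanAccept_mem_Icc`) is non-increasing on `[0, ∞)` and non-decreasing on
`(−∞, 0]`.** [ours] -/
theorem u1IdentityFlow_bhattCeiling_antitoneOn (V : ℕ) :
    AntitoneOn (fun β : ℝ => (besselI 0 (β / 2) ^ 2 / besselI 0 β) ^ V) (Ici (0 : ℝ)) ∧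
    MonotoneOn (fun β : ℝ => (besselI 0 (β / 2) ^ 2 / besselI 0 β) ^ V) (Iic (0 : ℝ)) :=
  ⟨antitoneOn_pow_of_nonneg (fun β => div_nonneg (sq_nonneg _) (besselI_zero_pos β).le)
      antitoneOn_besselI_half_sq_div V,
    monotoneOn_pow_of_nonneg (fun β => div_nonneg (sq_nonneg _) (besselI_zero_pos β).le)
      monotoneOn_besselI_half_sq_div V⟩

variable {ι : Type*} [Fintype ι]

/-- **THE EXACT ESS OF THE UNTRAINED U(1) SAMPLER IS NON-INCREASING IN THE COUPLING**: row 3's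
`u1IdentityFlow_essFrac` (`ESS_V = (I₀(β)²/I₀(2β))^V`, `V = card ι` independent plaquettes) is
antitone on `[0, ∞)` and monotone on `(−∞, 0]` as a function of `β`. [ours] -/
theorem u1IdentityFlow_essFrac_antitoneOn :
    AntitoneOn (fun β : ℝ =>
      (∫ x, ∏ i : ι, Real.exp (β * Real.cos (x i)) / onePlaquetteZ β
          ∂(Measure.pi fun _ : ι => volume.restrict (Ioc (0 : ℝ) (2 * π)))) ^ 2
        / ∫ x, (∏ i : ι, Real.exp (β * Real.cos (x i)) / onePlaquetteZ β) ^ 2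
            / ∏ _i : ι, (1 / (2 * π) : ℝ)
          ∂(Measure.pi fun _ : ι => volume.restrict (Ioc (0 : ℝ) (2 * π)))) (Ici (0 : ℝ)) ∧
    MonotoneOn (fun β : ℝ =>
      (∫ x, ∏ i : ι, Real.exp (β * Real.cos (x i)) / onePlaquetteZ β
          ∂(Measure.pi fun _ : ι => volume.restrict (Ioc (0 : ℝ) (2 * π)))) ^ 2
        / ∫ x, (∏ i : ι, Real.exp (β * Real.cos (x i)) / onePlaquetteZ β) ^ 2
            / ∏ _i : ι, (1 / (2 * π) : ℝ)
          ∂(Measure.pi fun _ : ι => volume.restrict (Ioc (0 : ℝ) (2 * π)))) (Iic (0 : ℝ)) := by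
  simp_rw [u1IdentityFlow_essFrac (ι := ι)]
  exact ⟨antitoneOn_pow_of_nonneg (fun β => div_nonneg (sq_nonneg _) (besselI_zero_pos _).le)
      antitoneOn_besselI_sq_div_double _,
    monotoneOn_pow_of_nonneg (fun β => div_nonneg (sq_nonneg _) (besselI_zero_pos _).le)
      monotoneOn_besselI_sq_div_double _⟩

end U1

end Summit.Ventures.LatticeQCDFlow.Theory2

end
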